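import Summits.BirchSwinnertonDyer.BirchSwinnertonDyer.Theorems.UniversalToricDescentStrictPlaceGrowthLayerCount
import Summits.BirchSwinnertonDyer.BirchSwinnertonDyer.Theorems.ThetaPartnerAtTwoSignedKatoUpToAtTwoLayerAwayTrivial
import Summits.BirchSwinnertonDyer.Rank1Residual.Additive.BaseChangeSubgroupH1
import HarnessLib

/-!
# Layer classes INTO Castella's group `Sel^{S′}_{q}(K_∞, E[p^∞])`, the tame dictionary «classical = away» over `Γ_n`, and the SEAM data
# of the layer `K_n` (crux ♭T≤ stmt-BirchSwinnertonDyer-23042, line `sigmacongruence`, stub R1 `stub_relaxedImageCount`, brick (b) part 2)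

Route `UniversalToricDescent`, lead prover `bsd-wall-utd-p1` g18. THEOREMS ONLY (no definition, no named fact, no `sorry`);
`--supports stmt-BirchSwinnertonDyer-23042`. BSD is not proved by any of this.

For `K` totally complex, `W/K` elliptic, a `ℤ_p`-extension `κ` (`Γ_n = κ⁻¹(pⁿℤ_p)`, `h_n = layerToInfty : H¹(Γ_n, E[p^∞]) → H¹(ker κ, E[p^∞])`):

* `layerToInfty_mem_selmerAc_of` — a class `y ∈ H¹(Γ_n, E[p^∞])` classical at every tame `u ∉ S′` (all conjugates) and LOCALLY TRIVIAL
  at the distinguished place `q` (all conjugates, `awayKer Γ_n E[p^∞] q`) has `h_n y ∈ Sel^{S′}_q(K_∞, E[p^∞])` (`selmerAc W p κ q S'`: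
  away off `S′ ∪ {v ∣ p}`, strict at `q`, nothing at the other places over `p`, nothing at complex places);
  `layerToInfty_mem_selmerAc_of_classical_off` — for `q` tame with `q ∉ S′` the local triviality at `q` is automatic.
* `localKerOver_layer_eq_awayKer` — at a tame `v`, the classical condition over `Γ_n` IS local triviality `awayKer Γ_n E[p^∞] v`
  (`SignedKatoOffTwo.LayerAway.localKerOver_layer_le_awayKer` + X2 `awayKer_le_localKerOver`).
* SEAM data of the layer `L = K_n` for the transports of `…RelaxedLayerTransportTorsion(Primary)`: `layerSubgroup_le_galRange_layer`
  (`Γ_n ≤ galRange K_n`), `mem_comapResGal_layer` (`res⁻¹ Γ_n = Γ_{K_n}`), and `baseChange_layer_fixed_eq_zero`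
  (`E_{K_n}[p^∞]^{Γ_{K_n}} = 0` when `E(K_∞)[p^∞] = 0`).

References: [GreenbergLNM1716] §2 Prop. 2.1 (p. 72), §3 Lemma 3.1 (pp. 85–87); [Castella2018] Def. 2.2; [GreenbergVatsal2000] §2 Prop. (2.1);
[Washington1997] §13.1 (the layers `K_n`).
-/

set_option linter.dupNamespace false
set_option autoImplicit false

noncomputable section
open scoped Classical
open CategoryTheory Field NumberField IsDedekindDomain Function
open Literature.NumberTheory.EllipticCurves Literature.NumberTheory.EllipticCurves.GreenbergSelmer
open Literature.NumberTheory.GaloisRepresentations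
open Literature.NumberTheory.GaloisCohomology
open scoped ContRepresentation
open scoped NumberField.LiesOver

namespace Summit.BirchSwinnertonDyer.BirchSwinnertonDyer.Theorems.UniversalToricDescentRelaxedLayerSelmer

open Summit.BirchSwinnertonDyer.Rank1Residual.X11b.KummerPT Summit.BirchSwinnertonDyer.Rank1Residual.X11b.LocBridge
  Summit.BirchSwinnertonDyer.Rank1Residual.X11b.Coinv Summit.BirchSwinnertonDyer.Rank1Residual.X11b.AcSelmer
  Summit.BirchSwinnertonDyer.Rank1Residual.Additive Summit.BirchSwinnertonDyer.Rank1Residual.Additive.BaseChange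
  Summit.BirchSwinnertonDyer.Rank1Residual.Additive.ZpTower
  Summit.BirchSwinnertonDyer.BirchSwinnertonDyer.Theorems.UniversalToricDescentLayerFixedPoints
  Summit.BirchSwinnertonDyer.BirchSwinnertonDyer.Theorems.UniversalToricDescentLayerDegreeCertificate

variable {K : Type} [Field K] [NumberField K] (W : WeierstrassCurve K) [W.IsElliptic] (p : ℕ) [Fact p.Prime]
  (κ : ZpExtension K p)

/-! ## §1 Layer classes into `Sel^{S′}_{q}(K_∞, E[p^∞])` -/

/-- **A layer class classical at every tame `u ∉ S′` and locally trivial at `q` (all conjugates) restricts into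
`Sel^{S′}_{q}(K_∞, E[p^∞])`** (`K` totally complex): restriction commutes with conjugation (`resOfLe_comp_conjH1`), preserves
the classical condition (`resOfLe_mem_localKerOver`) and local triviality (transitivity of restriction), classical ⟹ locally trivial
over `K_∞` at `u ∤ p` (`localKerOver_le_awayKer`), the strict clause at `q` is local triviality (`mem_selmerOver_iff_awayKer`), and
complex places impose nothing. [cite: GreenbergLNM1716, §2 Prop. 2.1 (p. 72), §3 p. 85–87] [cite: Castella2018, Def. 2.2 (arXiv:1704.06608 p. 5)] -/
theorem layerToInfty_mem_selmerAc_of [IsTotallyComplex K] (S' : Set (HeightOneSpectrum (𝓞 K))) (q : HeightOneSpectrum (𝓞 K))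
    (n : ℕ) (y : W.subgroupH1 p (κ.layerSubgroup n))
    (hy : ∀ u : HeightOneSpectrum (𝓞 K), ((p : ℕ) : 𝓞 K) ∉ u.asIdeal → u ∉ S' → ∀ σ : absoluteGaloisGroup K,
      W.conjH1 p (κ.layerSubgroup n) σ y ∈ W.localKerOver p (κ.layerSubgroup n) (u.adicCompletion K))
    (hq : ∀ σ : absoluteGaloisGroup K,
      W.conjH1 p (κ.layerSubgroup n) σ y ∈ awayKer (κ.layerSubgroup n) (W.geomPrimaryTorsion p) q) :
    W.layerToInfty κ n y ∈ selmerAc W p κ q S' := by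
  have hconj : ∀ σ : absoluteGaloisGroup K,
      W.conjH1 p κ.kerSubgroup σ (W.layerToInfty κ n y) = W.layerToInfty κ n (W.conjH1 p (κ.layerSubgroup n) σ y) := by
    intro σ
    have h := congrArg (fun f ↦ f y)
      (resOfLe_comp_conjH1_holds (M := W.geomPrimaryTorsion p) (κ.kerSubgroup_le_layerSubgroup n) σ)
    simp only [AddMonoidHom.coe_comp, Function.comp_apply] at h
    exact h.symm
  have haway : ∀ u : HeightOneSpectrum (𝓞 K), ((p : ℕ) : 𝓞 K) ∉ u.asIdeal → u ∉ S' → ∀ σ : absoluteGaloisGroup K,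
      W.conjH1 p κ.kerSubgroup σ (W.layerToInfty κ n y) ∈ awayKer κ.kerSubgroup (W.geomPrimaryTorsion p) u := by
    intro u hu huS σ
    rw [hconj]
    exact localKerOver_le_awayKer p κ u W hu (W.resOfLe_mem_localKerOver p _ _ (hy u hu huS σ))
  -- local triviality at `q` descends from `Γ_n` to `ker κ` (transitivity of restriction)
  have hq' : ∀ σ : absoluteGaloisGroup K,
      W.conjH1 p κ.kerSubgroup σ (W.layerToInfty κ n y) ∈ awayKer κ.kerSubgroup (W.geomPrimaryTorsion p) q := by
    intro σ
    rw [hconj]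
    have h := hq σ
    rw [awayKer, AddMonoidHom.mem_ker] at h ⊢
    have h1 : κ.kerSubgroup ⊓ decomp q ≤ κ.layerSubgroup n ⊓ decomp q := inf_le_inf_right _ (κ.kerSubgroup_le_layerSubgroup n)
    change resOfLe (W.geomPrimaryTorsion p) _ (resOfLe (W.geomPrimaryTorsion p) (κ.kerSubgroup_le_layerSubgroup n) _) = 0
    rw [← AddMonoidHom.comp_apply, resOfLe_comp_holds (M := W.geomPrimaryTorsion p),
      ← resOfLe_comp_holds (M := W.geomPrimaryTorsion p) h1 inf_le_left, AddMonoidHom.comp_apply]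
    change resOfLe (W.geomPrimaryTorsion p) h1 (resOfLe (W.geomPrimaryTorsion p) _ _) = 0
    rw [h, map_zero]
  change W.layerToInfty κ n y ∈ selmerOver κ.kerSubgroup (W.geomPrimaryTorsion p) p q S'
  rw [mem_selmerOver_iff_awayKer]
  refine ⟨fun v hpv hvS σ ↦ haway v hpv hvS σ, fun w σ ↦ ?_, fun σ ↦ hq' σ⟩
  exact mem_infKer_of_decompInf_eq_bot w (decompInf_eq_bot_of_isComplex (IsTotallyComplex.isComplex w)) _

/-! ## §2 At a tame place, classical over `Γ_n` = locally trivial -/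

/-- **`localKerOver Γ_n K_v = awayKer Γ_n E[p^∞] v` at every `v ∤ p`** (Greenberg's `Im κ_η = 0`, layer form).
[cite: GreenbergLNM1716, §2 Prop. 2.1 (p. 72)] -/
theorem localKerOver_layer_eq_awayKer (n : ℕ) {v : HeightOneSpectrum (𝓞 K)} (hpv : ((p : ℕ) : 𝓞 K) ∉ v.asIdeal) :
    W.localKerOver p (κ.layerSubgroup n) (v.adicCompletion K) = awayKer (κ.layerSubgroup n) (W.geomPrimaryTorsion p) v :=
  le_antisymm (SignedKatoOffTwo.LayerAway.localKerOver_layer_le_awayKer (κ := κ) (v := v) (W := W) (p := p) n hpv)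
    (Summit.BirchSwinnertonDyer.Rank1Residual.X2.GreenbergVatsalUnramifiedAway.awayKer_le_localKerOver (v := v) (W := W) (p := p)
      (κ.layerSubgroup n))

/-- **Tame distinguished place**: a layer class classical at every tame `u ∉ S′` restricts into `Sel^{S′}_{v₀}(K_∞, E[p^∞])` for any
tame `v₀ ∉ S′` (local triviality at `v₀` is the classical condition there, §2). [cite: GreenbergLNM1716, §2 Prop. 2.1 (p. 72)]
[cite: Castella2018, Def. 2.2 (arXiv:1704.06608 p. 5)] -/
theorem layerToInfty_mem_selmerAc_of_classical_off [IsTotallyComplex K] (S' : Set (HeightOneSpectrum (𝓞 K)))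
    (v₀ : HeightOneSpectrum (𝓞 K)) (hv₀ : ((p : ℕ) : 𝓞 K) ∉ v₀.asIdeal) (hv₀S : v₀ ∉ S') (n : ℕ)
    (y : W.subgroupH1 p (κ.layerSubgroup n))
    (hy : ∀ u : HeightOneSpectrum (𝓞 K), ((p : ℕ) : 𝓞 K) ∉ u.asIdeal → u ∉ S' → ∀ σ : absoluteGaloisGroup K,
      W.conjH1 p (κ.layerSubgroup n) σ y ∈ W.localKerOver p (κ.layerSubgroup n) (u.adicCompletion K)) :
    W.layerToInfty κ n y ∈ selmerAc W p κ v₀ S' := by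
  refine layerToInfty_mem_selmerAc_of W p κ S' v₀ n y hy fun σ ↦ ?_
  rw [← localKerOver_layer_eq_awayKer W p κ n hv₀]
  exact hy v₀ hv₀ hv₀S σ

/-! ## §3 The seam data of the layer `K_n` -/

/-- `Γ_n ≤ galRange K_n` (the SEAM `galRange K_n = Γ_n`). [cite: Washington1997, §13.1] -/
theorem layerSubgroup_le_galRange_layer (n : ℕ) : κ.layerSubgroup n ≤ galRange (K := K) (κ.layer n) :=
  (galRange_layer_eq_layerSubgroup κ n).ge

/-- `res⁻¹(Γ_n)` is all of `Γ_{K_n}`. [cite: Washington1997, §13.1] -/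
theorem mem_comapResGal_layer (n : ℕ) (τ : absoluteGaloisGroup (κ.layer n)) : τ ∈ comapResGal (κ.layer n) (κ.layerSubgroup n) := by
  rw [mem_comapResGal_iff, ← galRange_layer_eq_layerSubgroup κ n]
  exact ⟨τ, rfl⟩

omit [W.IsElliptic] in
/-- **`E_{K_n}[p^∞]^{Γ_{K_n}} = 0` when `E(K_∞)[p^∞] = 0`** (`natCard_fixed_baseChange_layer_eq_one`).
[cite: GreenbergLNM1716, §3 Lemma 3.1 (p. 86)] -/
theorem baseChange_layer_fixed_eq_zero (hB : FixedPoints.addSubgroup κ.kerSubgroup (W.geomPrimaryTorsion p) = ⊥) (n : ℕ)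
    (m : (W.baseChange (κ.layer n)).geomPrimaryTorsion p) (hm : ∀ σ : absoluteGaloisGroup (κ.layer n), σ • m = m) : m = 0 := by
  have h1 := natCard_fixed_baseChange_layer_eq_one W p κ hB n
  rw [Nat.card_eq_one_iff_unique] at h1
  have h2 := h1.1.elim ⟨m, hm⟩ ⟨0, fun σ ↦ smul_zero σ⟩
  exact congrArg Subtype.val h2

omit [NumberField K] [W.IsElliptic] in
/-- `E(K_∞)[p^∞] = 0` from the route's hypothesis «no `Gal(K̄/K_∞)`-fixed `p`-torsion»: for a fixed `m` with `p^{n+1} m = 0`,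
`p^n m` is fixed and killed by `p`, hence `0`; induct. [cite: GreenbergLNM1716, §3 Lemma 3.1 (p. 86)] -/
theorem fixedPoints_kerSubgroup_eq_bot_of
    (h : ∀ m : W.geomPrimaryTorsion p, (∀ σ ∈ κ.kerSubgroup, σ • m = m) → p • m = 0 → m = 0) :
    FixedPoints.addSubgroup κ.kerSubgroup (W.geomPrimaryTorsion p) = ⊥ := by
  rw [eq_bot_iff]
  intro m hm
  rw [AddSubgroup.mem_bot]
  have hfix : ∀ σ ∈ κ.kerSubgroup, σ • m = m := fun σ hσ ↦ hm ⟨σ, hσ⟩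
  obtain ⟨n, hn⟩ := (AddCommGroup.mem_primaryComponent).mp m.2
  have hn' : p ^ n • m = 0 := Subtype.ext (by rw [AddSubgroupClass.coe_nsmul, hn]; rfl)
  clear hn hm
  induction n generalizing m with
  | zero => simpa using hn'
  | succ n ih =>
    have hfix' : ∀ σ ∈ κ.kerSubgroup, σ • (p ^ n • m) = p ^ n • m := fun σ hσ ↦ by rw [smul_comm, hfix σ hσ]
    have h0 : p ^ n • m = 0 := h _ hfix' (by rw [← mul_nsmul, ← pow_succ, hn'])
    exact ih hfix h0

end Summit.BirchSwinnertonDyer.BirchSwinnertonDyer.Theorems.UniversalToricDescentRelaxedLayerSelmer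

end
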